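import Summits.ValiantsHypothesis.ValiantsHypothesis.Theorems.KPlusLogSqLawTropicalBStaticFiveTriangleExtract

/-!
# `TropicalB` (stmt-ValiantsHypothesis-19771) — the static `5 × 5` cell, TRIANGLE LAW: the law, its transport to every row triple, and `T_static(5) ≤ 66`

Cell `pub-symmetroid`, seat val-sym-trop-p4 (g8).  HONEST FRAMING: a finite STATIC (Birkhoff-shadow) census statement at size `5` in the currency
of `TropicalB`'s orbit (stmt-ValiantsHypothesis-19771); nothing here bears on `TropicalB` in its window, `WeakLifting`, `MatrixDescartes`
(stmt-ValiantsHypothesis-18050) or VP ≠ VNP.  Memo `HOME/val-sym-trop-p4/g8/TRIANGLE-LAW-g8.md`.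

THE TRIANGLE LAW (four files `…StaticFiveTriangleTables / …Laws / …Extract / …Triangle`): in a STATIC `5 × 5` design the three `S₂ × S₃`
cosets `σ({0,1}) = {0,1}, {0,2}, {1,2}` of dominant permutations (at most `7` each) are never simultaneously full, so at most `20` terms of a dominant
chain send the columns `0,1` into a given row triple, and by double counting over the `10` row triples a static `5 × 5` design has at most `66`
dominant terms along a chain (`static_row_five_sixtyfive`, record `69 + 1 = 70` of `StaticHalving.static_row_five`).  PROOF (memo §4): split-square law
(`ExchangeSquare.not_dominant_split_square`, p493290) inside a coset (`S = {0,1}`) and across cosets (`S` = a column pair of `{2,3,4}`), EDGE RULE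
(diagonal bracketing `Bracketing.slope_bracket_split`, p522470), slope LATIN identity + parity-class law (p522470) = LEMMA X
(`StaticFiveTriangle.coset_core_*`, p542783), sign chain `StaticFiveTriangle.triangle_core` through the common block exchanges of rows `3, 4`.
The `36` permutations of the family are `perm36 i l u` (coset `i : Fin 3` = rows `(0,1),(0,2),(1,2)` on columns `0,1`; left `l : Fin 2`, `l = 0` =
smaller row at column `0`; right `u : Fin 6` = the bijection columns `(2,3,4) → (y,3,4)` composed with the `u`-th element of `S₃` in the order
`id, (120), (201), (021), (210), (102)` — `0,1,2` even, `3,4,5` odd, pairs `{u, u+3}` = positions `34, 23, 24`).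

THIS FILE: `static_triangle_base` (no `21` chain terms send columns `0,1` into rows `{0,1,2}`: cosets exactly `7` each ⇒ pivots at the three positions by the cross law ⇒ extraction ×3 ⇒ `triangle_core`); `static_triangle_rows` (any row triple, by row relabelling p-Relabel); `card_into_triple_le` (≤ 20 per triple); **`static_row_five_sixtyfive : IsStatic ε → DesignRowD d v ε 65`** and **`tropRootLawAtStatic_five_sixtyfive (K) : TropRootLawAtStatic 5 K 65`** by double counting over the `10` row triples.
[this seat]
-/

set_option linter.dupNamespace false
set_option autoImplicit false

namespace Summit.ValiantsHypothesis.ValiantsHypothesis.Theorems.KPlusLogSqLaw.StaticFiveTriangle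

open Summit.ValiantsHypothesis.ValiantsHypothesis.Theorems.MatrixDescartes.Negative
open Summit.ValiantsHypothesis.ValiantsHypothesis.Theorems.LacunarySymmetroidMatrixDescartes
open Summit.ValiantsHypothesis.ValiantsHypothesis.Theorems.LacunarySymmetroidMatrixDescartes.TropicalCensus
open Finset

/-! ### 8. The triangle law at the base position -/

/-- **TRIANGLE LAW (base position).**  In a static `5 × 5` design, a chain of dominant terms at strictly increasing parameters with pairwise
different consecutive terms does not contain `21` terms whose columns `0, 1` are matched into the rows `{0, 1, 2}`. -/
theorem static_triangle_base {K : ℕ} (d : Fin K → ℕ) (v ε : Fin 5 → Fin 5 → Fin K → ℤ) (hs : IsStatic ε)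
    {n : ℕ} (θ : Fin (n + 1) → ℤ) (p : Fin (n + 1) → Equiv.Perm (Fin 5) × (Fin 5 → Fin K))
    (hθ : StrictMono θ) (hdom : ∀ k, IsDominant d v ε (θ k) (p k)) (hne : ∀ k : Fin n, p k.castSucc ≠ p k.succ)
    (g : Fin 21 → Fin (n + 1)) (hg : Function.Injective g)
    (hX : ∀ t, ((p (g t)).1 0).val < 3 ∧ ((p (g t)).1 1).val < 3) : False := by
  classical
  -- a class table hitting a present class wherever there is one
  have l₀ : Fin K := (p 0).2 0
  have hex : ∀ r c : Fin 5, ∃ l : Fin K, ∀ l', ε r c l' ≠ 0 → ε r c l ≠ 0 := by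
    intro r c
    by_cases h : ∃ l', ε r c l' ≠ 0
    · obtain ⟨l', hl'⟩ := h
      exact ⟨l', fun _ _ => hl'⟩
    · exact ⟨l₀, fun l' hl' => absurd ⟨l', hl'⟩ h⟩
  choose cls hcls' using hex
  have hcls : ∀ r c l, ε r c l ≠ 0 → ε r c (cls r c) ≠ 0 := fun r c l h => hcls' r c l h
  have hinj := injective_of_chainD d v ε θ p hθ hdom hne
  -- in a static design the permutation determines the term
  have hcl : ∀ (a b : Fin (n + 1)) (c : Fin 5), (p a).1 c = (p b).1 c → (p a).2 c = (p b).2 c := by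
    intro a b c hab
    have ha := present_of_termSign_ne_zero ε (p a) (hdom a).1 c
    have hb := present_of_termSign_ne_zero ε (p b) (hdom b).1 c
    rw [hab] at ha
    exact hs _ _ _ _ ha hb
  have hperm : ∀ a b : Fin (n + 1), (p a).1 = (p b).1 → p a = p b := fun a b hab =>
    ExchangeSquare.term_eq_of_agree fun c => ⟨by rw [hab], hcl a b c (by rw [hab])⟩
  -- locate the 21 selected terms in the family
  have hloc : ∀ t, ∃ x : Fin 3 × Fin 2 × Fin 6, perm36 x.1 x.2.1 x.2.2 = (p (g t)).1 := fun t => by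
    obtain ⟨i, l, u, h⟩ := perm36_surj _ (hX t).1 (hX t).2
    exact ⟨(i, l, u), h⟩
  choose φ hφ using hloc
  have φinj : Function.Injective φ := by
    intro t t' h
    apply hg; apply hinj; apply hperm
    rw [← hφ t, ← hφ t', h]
  set S : Finset (Fin 3 × Fin 2 × Fin 6) := univ.image φ with hSdef
  have hS : #S = 21 := by rw [hSdef, card_image_of_injective _ φinj]; simp
  have hW : ∀ x ∈ S, (∃ k, (p k).1 = perm36 x.1 x.2.1 x.2.2) := by
    intro x hx
    obtain ⟨t, -, rfl⟩ := mem_image.1 hx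
    exact ⟨g t, (hφ t).symm⟩
  -- the three cosets
  set T : Fin 3 → Finset (Fin 2 × Fin 6) := fun i => (S.filter fun x => x.1 = i).image Prod.snd with hTdef
  have hT : ∀ i l u, (l, u) ∈ T i → (∃ k, (p k).1 = perm36 i l u) := by
    intro i l u h
    obtain ⟨x, hx, hx2⟩ := mem_image.1 h
    obtain ⟨hxS, hxi⟩ := mem_filter.1 hx
    have := hW x hxS
    rw [hxi, hx2] at this
    exact this
  have hTcard : ∀ i, #(T i) = #(S.filter fun x => x.1 = i) := by
    intro i
    apply card_image_of_injOn
    intro x hx y hy hxy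
    simp only [coe_filter, Set.mem_setOf_eq] at hx hy
    exact Prod.ext (hx.2.trans hy.2.symm) hxy
  have hsumS : #S = ∑ i : Fin 3, #(S.filter fun x => x.1 = i) :=
    card_eq_sum_card_fiberwise (f := fun x : Fin 3 × Fin 2 × Fin 6 => x.1) fun _ _ => mem_univ _
  -- the split-square law inside each coset: at most 7 each, hence exactly 7 each
  have hsq : ∀ i (u u' : Fin 6), u ≠ u' → ¬((0, u) ∈ T i ∧ (0, u') ∈ T i ∧ (1, u) ∈ T i ∧ (1, u') ∈ T i) :=
    fun i u u' huu h => sq_int d v hs hcls hdom huu (hT i 0 u h.1) (hT i 0 u' h.2.1) (hT i 1 u h.2.2.1) (hT i 1 u' h.2.2.2)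
  have hle7 : ∀ i, #(T i) ≤ 7 := fun i => (coset_count (T i) (hsq i)).1
  have h7 : ∀ i, #(T i) = 7 := by
    have hsum : #(T 0) + #(T 1) + #(T 2) = 21 := by
      rw [hTcard, hTcard, hTcard, ← hS, hsumS, Fin.sum_univ_three]
    have a0 := hle7 0; have a1 := hle7 1; have a2 := hle7 2
    intro i
    fin_cases i
    · show #(T 0) = 7; omega
    · show #(T 1) = 7; omega
    · show #(T 2) = 7; omega
  -- pivots and purity
  have hpiv : ∀ i, ∃ k : Fin 6, ((0, k) ∈ T i ∧ (1, k) ∈ T i) ∧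
      ∀ u : Fin 6, u ≠ k → (((0, u) ∈ T i ∧ (1, u) ∉ T i) ∨ ((0, u) ∉ T i ∧ (1, u) ∈ T i)) := fun i => by
    obtain ⟨k, h0, h1, h⟩ := (coset_count (T i) (hsq i)).2 (h7 i)
    exact ⟨k, ⟨h0, h1⟩, h⟩
  choose kp hkp hpure using hpiv
  -- pivot positions and the cross law
  let P : Fin 3 → Fin 3 := fun i => ⟨(kp i).val % 3, Nat.mod_lt _ (by norm_num)⟩
  let dbl : Fin 3 → Fin 3 → Prop := fun i q => ((0, evn q) ∈ T i ∧ (0, prt q) ∈ T i) ∨ ((1, evn q) ∈ T i ∧ (1, prt q) ∈ T i)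
  have hdblP : ∀ i, dbl i (P i) := by
    intro i
    -- the pivot is one of the two members of the pair at its position; its partner carries some left
    have hk : kp i = evn (P i) ∨ kp i = prt (P i) := by
      have h6 := (kp i).isLt
      by_cases h3 : (kp i).val < 3
      · left; apply Fin.ext; simp only [evn, P]; omega
      · right; apply Fin.ext; simp only [prt, P]; omega
    rcases hk with hk | hk
    · have hq : prt (P i) ≠ kp i := by rw [hk]; simp [evn, prt, Fin.ext_iff]
      rcases hpure i (prt (P i)) hq with ⟨h0, -⟩ | ⟨-, h1⟩
      · exact Or.inl ⟨hk ▸ (hkp i).1, h0⟩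
      · exact Or.inr ⟨hk ▸ (hkp i).2, h1⟩
    · have hq : evn (P i) ≠ kp i := by rw [hk]; simp [evn, prt, Fin.ext_iff]
      rcases hpure i (evn (P i)) hq with ⟨h0, -⟩ | ⟨-, h1⟩
      · exact Or.inl ⟨h0, hk ▸ (hkp i).1⟩
      · exact Or.inr ⟨h1, hk ▸ (hkp i).2⟩
  have hcross : ∀ i j q, i ≠ j → dbl i q → dbl j q → False := by
    intro i j q hij hi hj
    have nij : ∀ l l' : Fin 2, ((i, l) : Fin 3 × Fin 2) ≠ (j, l') := fun l l' h => hij (congrArg Prod.fst h)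
    rcases hi with ⟨a, b⟩ | ⟨a, b⟩ <;> rcases hj with ⟨c, e⟩ | ⟨c, e⟩
    · exact sq_cross d v hs hcls hdom (nij 0 0) q (hT _ _ _ a) (hT _ _ _ c) (hT _ _ _ b) (hT _ _ _ e)
    · exact sq_cross d v hs hcls hdom (nij 0 1) q (hT _ _ _ a) (hT _ _ _ c) (hT _ _ _ b) (hT _ _ _ e)
    · exact sq_cross d v hs hcls hdom (nij 1 0) q (hT _ _ _ a) (hT _ _ _ c) (hT _ _ _ b) (hT _ _ _ e)
    · exact sq_cross d v hs hcls hdom (nij 1 1) q (hT _ _ _ a) (hT _ _ _ c) (hT _ _ _ b) (hT _ _ _ e)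
  have Pinj : Function.Injective P := by
    intro i j h
    by_contra hij
    exact hcross i j (P i) hij (hdblP i) (h ▸ hdblP j)
  have Psurj : Function.Surjective P := Finite.surjective_of_injective Pinj
  -- away from its pivot's position a coset has no left-sharing pair
  have hsep : ∀ i (q : Fin 3), q.val ≠ (kp i).val % 3 →
      ¬((0, evn q) ∈ T i ∧ (0, prt q) ∈ T i) ∧ ¬((1, evn q) ∈ T i ∧ (1, prt q) ∈ T i) := by
    intro i q hq
    obtain ⟨j, hj⟩ := Psurj q
    have hij : i ≠ j := by
      rintro rfl
      apply hq
      have := congrArg Fin.val hj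
      simpa [P] using this.symm
    have hjq : dbl j q := hj ▸ hdblP j
    exact ⟨fun h => hcross i j q hij (Or.inl h) hjq, fun h => hcross i j q hij (Or.inr h) hjq⟩
  -- extraction in the three cosets, ordered by pivot position
  obtain ⟨a, ha⟩ := Psurj 0
  obtain ⟨b, hb⟩ := Psurj 1
  obtain ⟨c, hc⟩ := Psurj 2
  have ma : (kp a).val % 3 = 0 := by have := congrArg Fin.val ha; simpa [P] using this
  have mb : (kp b).val % 3 = 1 := by have := congrArg Fin.val hb; simpa [P] using this
  have mc : (kp c).val % 3 = 2 := by have := congrArg Fin.val hc; simpa [P] using this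
  obtain ⟨trA, xA, -, -⟩ := coset_extract d v hs hcls hθ hdom a (T a) (hT a) (kp a) (hkp a) (hpure a) (hsep a)
  obtain ⟨trB, -, xB, -⟩ := coset_extract d v hs hcls hθ hdom b (T b) (hT b) (kp b) (hkp b) (hpure b) (hsep b)
  obtain ⟨trC, -, -, xC⟩ := coset_extract d v hs hcls hθ hdom c (T c) (hT c) (kp c) (hkp c) (hpure c) (hsep c)
  exact triangle_core _ _ _ (Bq (aOf d cls) 1) (Bq (aOf d cls) 2) (Bq (aOf d cls) 0)
    (tsgn (T a) 1) (tsgn (T a) 2) (tsgn (T b) 0) (tsgn (T b) 2) (tsgn (T c) 0) (tsgn (T c) 1)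
    (xA ma) (xB mb) (xC mc)
    (trA 1 (by omega)) (trC 1 (by omega)) (trA 2 (by omega)) (trB 2 (by omega)) (trB 0 (by omega)) (trC 0 (by omega))

/-! ### 9. Transport to every row triple, double counting, and the census row `T_static(5) ≤ 66` -/

/-- the triangle law for the row triple `π {0,1,2}` (columns `0, 1`), by relabelling the rows. -/
theorem static_triangle_rows {K : ℕ} (d : Fin K → ℕ) (v ε : Fin 5 → Fin 5 → Fin K → ℤ) (hs : IsStatic ε)
    {n : ℕ} (θ : Fin (n + 1) → ℤ) (p : Fin (n + 1) → Equiv.Perm (Fin 5) × (Fin 5 → Fin K))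
    (hθ : StrictMono θ) (hdom : ∀ k, IsDominant d v ε (θ k) (p k)) (hne : ∀ k : Fin n, p k.castSucc ≠ p k.succ)
    (π : Equiv.Perm (Fin 5)) (g : Fin 21 → Fin (n + 1)) (hg : Function.Injective g)
    (hX : ∀ t, (π⁻¹ ((p (g t)).1 0)).val < 3 ∧ (π⁻¹ ((p (g t)).1 1)).val < 3) : False := by
  -- the relabelled design (rows by `π`, columns fixed) and chain
  let q : Fin (n + 1) → Equiv.Perm (Fin 5) × (Fin 5 → Fin K) := fun k => (π⁻¹ * (p k).1, (p k).2)
  have hq : ∀ k, ((π * (q k).1 * (1 : Equiv.Perm (Fin 5))⁻¹ : Equiv.Perm (Fin 5)), fun j => (q k).2 ((1 : Equiv.Perm (Fin 5))⁻¹ j)) = p k := by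
    intro k
    refine Prod.ext ?_ (funext fun j => ?_)
    · show π * (π⁻¹ * (p k).1) * 1⁻¹ = (p k).1
      simp [← mul_assoc]
    · simp [q]
  have hdom' : ∀ k, IsDominant d (fun a b l => v (π a) ((1 : Equiv.Perm (Fin 5)) b) l) (fun a b l => ε (π a) ((1 : Equiv.Perm (Fin 5)) b) l) (θ k) (q k) :=
    fun k => (isDominant_relabel_iff d v ε π 1 (q k) (θ k)).mp (by rw [hq]; exact hdom k)
  have hs' : IsStatic (fun a b l => ε (π a) ((1 : Equiv.Perm (Fin 5)) b) l) := fun _ _ _ _ h h' => hs _ _ _ _ h h'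
  have hne' : ∀ k : Fin n, q k.castSucc ≠ q k.succ := by
    intro k h
    apply hne k
    rw [← hq k.castSucc, ← hq k.succ, h]
  refine static_triangle_base d _ _ hs' θ q hθ hdom' hne' g hg fun t => ?_
  show (((π⁻¹ * (p (g t)).1) : Equiv.Perm (Fin 5)) 0).val < 3 ∧ (((π⁻¹ * (p (g t)).1) : Equiv.Perm (Fin 5)) 1).val < 3
  simpa [Equiv.Perm.mul_apply] using hX t

/-- every row triple is `π {0,1,2}` for some row permutation `π`. -/
theorem exists_perm_of_card_three : ∀ X : Finset (Fin 5), #X = 3 → ∃ π : Equiv.Perm (Fin 5), ∀ r : Fin 5, r ∈ X ↔ (π⁻¹ r).val < 3 := by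
  decide +kernel

/-- there are `10` row triples. -/
theorem card_triples : #((univ : Finset (Finset (Fin 5))).filter fun X => #X = 3) = 10 := by decide +kernel

/-- a row pair lies in exactly `3` row triples. -/
theorem card_triples_containing (a b : Fin 5) (hab : a ≠ b) :
    #(((univ : Finset (Finset (Fin 5))).filter fun X => #X = 3).filter fun X => a ∈ X ∧ b ∈ X) = 3 := by
  revert hab
  revert a b
  decide +kernel

/-- **at most `20` chain terms send the columns `0, 1` into a given row triple.** -/
theorem card_into_triple_le {K : ℕ} (d : Fin K → ℕ) (v ε : Fin 5 → Fin 5 → Fin K → ℤ) (hs : IsStatic ε)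
    {n : ℕ} (θ : Fin (n + 1) → ℤ) (p : Fin (n + 1) → Equiv.Perm (Fin 5) × (Fin 5 → Fin K))
    (hθ : StrictMono θ) (hdom : ∀ k, IsDominant d v ε (θ k) (p k)) (hne : ∀ k : Fin n, p k.castSucc ≠ p k.succ)
    (X : Finset (Fin 5)) (hX : #X = 3) :
    #((univ : Finset (Fin (n + 1))).filter fun k => (p k).1 0 ∈ X ∧ (p k).1 1 ∈ X) ≤ 20 := by
  by_contra hgt
  obtain ⟨F, hFsub, hF⟩ := Finset.exists_subset_card_eq (show 21 ≤ #((univ : Finset (Fin (n + 1))).filter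
    fun k => (p k).1 0 ∈ X ∧ (p k).1 1 ∈ X) by omega)
  obtain ⟨π, hπ⟩ := exists_perm_of_card_three X hX
  let g : Fin 21 → Fin (n + 1) := fun t => F.orderEmbOfFin hF t
  have hg : Function.Injective g := fun t t' h => (F.orderEmbOfFin hF).injective h
  refine static_triangle_rows d v ε hs θ p hθ hdom hne π g hg fun t => ?_
  have hmem : g t ∈ F := Finset.orderEmbOfFin_mem F hF t
  have := (mem_filter.1 (hFsub hmem)).2
  exact ⟨(hπ _).1 this.1, (hπ _).1 this.2⟩

/-- **THE STATIC `5 × 5` CELL IS AT MOST `66`**: a static `5 × 5` design has at most `66` dominant terms along any chain with pairwise different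
consecutive terms (`DesignRowD d v ε 65`, every `K`).  Double counting of the triangle law over the `10` row triples (each row pair lies in `3`). -/
theorem static_row_five_sixtyfive {K : ℕ} (d : Fin K → ℕ) (v ε : Fin 5 → Fin 5 → Fin K → ℤ) (hs : IsStatic ε) :
    DesignRowD d v ε 65 := by
  classical
  intro n θ p hθ hdom hne
  set Xs := (univ : Finset (Finset (Fin 5))).filter fun X => #X = 3 with hXs
  -- Σ over triples of the number of terms inside = Σ over terms of the number of triples containing its row pair = 3 (n + 1)
  have hcount : ∑ X ∈ Xs, #((univ : Finset (Fin (n + 1))).filter fun k => (p k).1 0 ∈ X ∧ (p k).1 1 ∈ X) =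
      ∑ k : Fin (n + 1), #(Xs.filter fun X => (p k).1 0 ∈ X ∧ (p k).1 1 ∈ X) := by
    simp only [Finset.card_filter]
    exact Finset.sum_comm
  have hthree : ∀ k : Fin (n + 1), #(Xs.filter fun X => (p k).1 0 ∈ X ∧ (p k).1 1 ∈ X) = 3 := by
    intro k
    have hab : (p k).1 0 ≠ (p k).1 1 := fun h => by have := (p k).1.injective h; exact absurd this (by decide)
    rw [hXs]
    exact card_triples_containing _ _ hab
  have hle : ∀ X ∈ Xs, #((univ : Finset (Fin (n + 1))).filter fun k => (p k).1 0 ∈ X ∧ (p k).1 1 ∈ X) ≤ 20 := by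
    intro X hXmem
    exact card_into_triple_le d v ε hs θ p hθ hdom hne X (mem_filter.1 hXmem).2
  have h1 : ∑ X ∈ Xs, #((univ : Finset (Fin (n + 1))).filter fun k => (p k).1 0 ∈ X ∧ (p k).1 1 ∈ X) ≤ 10 * 20 := by
    calc _ ≤ ∑ X ∈ Xs, 20 := Finset.sum_le_sum hle
      _ = #Xs * 20 := by rw [Finset.sum_const, smul_eq_mul]
      _ = 10 * 20 := by rw [hXs, card_triples]
  have h2 : ∑ k : Fin (n + 1), #(Xs.filter fun X => (p k).1 0 ∈ X ∧ (p k).1 1 ∈ X) = 3 * (n + 1) := by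
    simp only [hthree, Finset.sum_const, Finset.card_univ, Fintype.card_fin, smul_eq_mul]
    ring
  omega

/-- **the static size-`5` tropical row is at most `65` breakpoints (`66` terms) for every `K`** (record `69`, `StaticHalving.static_row_five`). -/
theorem tropRootLawAtStatic_five_sixtyfive (K : ℕ) : TropRootLawAtStatic 5 K 65 :=
  fun d v ε _ θ p _ hs hθ hdom halt => le_of_designRowD (static_row_five_sixtyfive d v ε hs) θ p hθ hdom halt


end Summit.ValiantsHypothesis.ValiantsHypothesis.Theorems.KPlusLogSqLaw.StaticFiveTriangle
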